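import Literature.NumberTheory.EllipticCurves.X1ElevenKummerDivisor
import Literature.NumberTheory.EllipticCurves.KubertTateFive
import HarnessLib

/-!
# The divisor of the Kummer function `f_T = xy - n x² + n² y` on the Kubert–Tate `5`-torsion family:
# `div f_T = 5(T) - 5(O)`, over any field

PROOF-ONLY file (theorems and three small definitions with bodies), topic
`NumberTheory/EllipticCurves`. For the integral model
`E_{m,n} = kubertTateFive m n : y² + (n-m)xy - mn²y = x³ - mnx²` of the universal elliptic curve with
a point `T = (0,0)` of order `5` (Knapp (5.31); tree `KubertTateFive`) over a field `F`
characteristic `0` with `E_{m,n}` elliptic (`m n (m² - 11mn - n²) ≠ 0`), the function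

  `f_T = x y - n x² + n² y ∈ F̄(E_{m,n})`

has divisor `5(T) - 5(O)`: it is the Kummer function of the descent through the dual of
`E → E/⟨T⟩` (Silverman, *AEC*, Exercise 10.1(c): `E(K)/φ̂(E'(K)) ↪ Kˣ/Kˣ⁵`, `P ↦ f_T(P)`).
This is the analogue, for the whole family and any ground field, of the tree's
`X1ElevenKummerDivisor` (`11A3`, `f_T = xy + x² + y`), whose proof it follows line by line, with
the tree's point-indexed order function `WeierstrassFunctionField.ord` on `F̄(E)`:

* `ord_zero_kummerFn` — `ord_O f_T = -5` (`f_T = (-n x²)·1 + (x + n²)·y`, norm degree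
  `max(4, 2 + 3) = 5`);
* `eq_zero_of_kummer_eq_zero` — the only affine zero is `T` (`f_T · f_{-T} = -x⁵`, file
  `KubertTateFiveKummerValuation`, and `f_T(0, y) = n² y`);
* `ord_Tbar_kummerFn` — `ord_T f_T = 5` (degree of a principal divisor is `0`);
* `ord_kummerFn` — **`ord_Q f_T = 5([Q = T̄] - [Q = O])`**, the divisor hypothesis of the tree's
  `WeierstrassCurve.exists_stableCoset_of_kummer_eq_pow` (`IsogenyDescentWeilFunction`);
* `hasValueAt_kummerFn` — `f_T(x, y) = xy - nx² + n²y` at affine points.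

## References

* [SilvermanAEC2009] J. H. Silverman, *The Arithmetic of Elliptic Curves*, 2nd ed. (2009),
  Exercise 10.1 (PDF p. 304), Prop. II.3.1, III.§8.
* [Fisher2001FiveSevenDescent] T. Fisher, JEMS 3 (2001), §§1–2 (the `5`-descent on the Tate
  normal form).
* [Knapp1993] A. W. Knapp, *Elliptic Curves*, (5.31).

## Design

Generic in the field `F` and in `m n : F`, with `[(kubertTateFive m n).IsElliptic]`
as an instance argument; so the file serves the curve `E_{13/14}` over `ℚ` and over every
completion `ℚ_v` alike.
-/

noncomputable section

open scoped Classical WithZero Polynomial.Bivariate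
open Polynomial WeierstrassCurve
open Literature.NumberTheory.EllipticCurves.WeierstrassFunctionField WeierstrassCurve.geomPoints

namespace Literature.NumberTheory.EllipticCurves

namespace KubertTateKummer

open Literature.NumberTheory.EllipticCurves

universe u

variable {F : Type u} [Field F] (m n : F) [hE : (kubertTateFive m n).IsElliptic]

/-! ### The curve over `F̄` -/

omit hE in
/-- The coefficients of `E_{m,n} ⊗ F̄`: `kubertTateFive (m : F̄) (n : F̄)`. [cite: Knapp1993, (5.31)] -/
theorem baseChange_eq : (kubertTateFive m n).baseChange (AlgebraicClosure F) =
    kubertTateFive (algebraMap F (AlgebraicClosure F) m) (algebraMap F (AlgebraicClosure F) n) :=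
  map_kubertTateFive m n _

omit hE in
/-- `n ≠ 0` when the curve is elliptic. [cite: Knapp1993, (5.31)] -/
theorem n_ne_zero (h : (kubertTateFive m n).IsElliptic) : n ≠ 0 := by
  intro h0
  have h1 := h.isUnit.ne_zero
  rw [kubertTateFive_Δ, h0] at h1
  exact h1 (by ring)

/-- The nonsingular `F̄`-points of `E_{m,n}` are the solutions of
`y² + (n-m)xy - mn²y = x³ - mnx²` (with `m, n` read in `F̄`). [cite: Knapp1993, (5.31)] -/
theorem nonsingular_geom_iff (x y : (AlgebraicClosure F)) :
    ((kubertTateFive m n).baseChange (AlgebraicClosure F)).toAffine.Nonsingular x y ↔ y ^ 2 + (algebraMap F (AlgebraicClosure F) n - algebraMap F (AlgebraicClosure F) m) * x * y -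
      algebraMap F (AlgebraicClosure F) m * algebraMap F (AlgebraicClosure F) n ^ 2 * y = x ^ 3 - algebraMap F (AlgebraicClosure F) m *
        algebraMap F (AlgebraicClosure F) n * x ^ 2 := by
  have hΔ : ((kubertTateFive m n).baseChange (AlgebraicClosure F)).Δ ≠ 0 := by
    rw [WeierstrassCurve.baseChange, map_Δ]
    exact (_root_.map_ne_zero _).mpr hE.isUnit.ne_zero
  rw [← Affine.equation_iff_nonsingular_of_Δ_ne_zero hΔ, Affine.equation_iff]
  simp only [WeierstrassCurve.baseChange, map_a₁, map_a₂, map_a₃, map_a₄, map_a₆, kubertTateFive_a₁,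
    kubertTateFive_a₂, kubertTateFive_a₃, kubertTateFive_a₄, kubertTateFive_a₆, map_zero, map_neg,
    map_sub, map_mul, map_pow]
  constructor <;> intro h <;> linear_combination h

/-- `(0, 0)` is a nonsingular point of `E_{m,n}/F̄`. [cite: Knapp1993, (5.31)] -/
theorem nonsingular_zero_zero : ((kubertTateFive m n).baseChange (AlgebraicClosure F)).toAffine.Nonsingular 0 0 :=
  (nonsingular_geom_iff m n 0 0).mpr (by ring)

/-- The geometric point `T̄ = (0, 0)` (marked point of order `5`). [cite: Knapp1993, (5.31)] -/
def Tbar : geomPoints (kubertTateFive m n) :=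
  Affine.Point.some 0 0 (nonsingular_zero_zero m n)

/-- `T̄ ≠ O`. [cite: Knapp1993, (5.31)] -/
theorem Tbar_ne_zero : Tbar m n ≠ 0 :=
  Affine.Point.some_ne_zero _

/-! ### The Kummer function -/

/-- `f_T` as a two-variable polynomial: `X₀ X₁ - n X₀² + n² X₁`.
[cite: SilvermanAEC2009, Exercise 10.1(c) (PDF p. 304)] -/
def kummerPoly : MvPolynomial (Fin 2) (AlgebraicClosure F) :=
  MvPolynomial.X 0 * MvPolynomial.X 1 - MvPolynomial.C (algebraMap F (AlgebraicClosure F) n) * MvPolynomial.X 0 ^ 2 +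
    MvPolynomial.C (algebraMap F (AlgebraicClosure F) n ^ 2) * MvPolynomial.X 1

/-- `kummerPoly` under the identification `F̄[x][y] ≃ F̄[X₀, X₁]`. [cite: SilvermanAEC2009, Exercise 10.1(c) (PDF p. 304)] -/
theorem equivMvPolynomial_symm_kummerPoly :
    (Polynomial.Bivariate.equivMvPolynomial (AlgebraicClosure F)).symm (kummerPoly n) =
      C (-(C (algebraMap F (AlgebraicClosure F) n) * X ^ 2)) + C (X + C (algebraMap F (AlgebraicClosure F) n ^ 2)) * Y := by
  simp only [kummerPoly, map_add, map_sub, map_mul, map_pow,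
    Polynomial.Bivariate.equivMvPolynomial_symm_X_0,
    Polynomial.Bivariate.equivMvPolynomial_symm_X_1, Polynomial.Bivariate.equivMvPolynomial_symm_C,
    map_neg]
  ring

/-- **The Kummer function `f_T = xy - nx² + n²y ∈ F̄(E_{m,n})`** (evaluation of `kummerPoly` at the
generic point). [cite: SilvermanAEC2009, Exercise 10.1(c) (PDF p. 304)] -/
def kummerFn : (kubertTateFive m n).geomFunctionField := (kubertTateFive m n).evalGeneric (kummerPoly n)

/-- `f_T` in the coordinate ring `F̄[E_{m,n}]`, in the basis `1, y` over `F̄[x]`: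
`(-n x²) · 1 + (x + n²) · y`. [cite: SilvermanAEC2009, Exercise 10.1(c) (PDF p. 304)] -/
def kummerCR : Affine.CoordinateRing ((kubertTateFive m n).baseChange (AlgebraicClosure F)).toAffine :=
  (-(C (algebraMap F (AlgebraicClosure F) n) * X ^ 2) : (AlgebraicClosure F)[X]) • (1 : Affine.CoordinateRing ((kubertTateFive m n).baseChange (AlgebraicClosure F)).toAffine) +
    (X + C (algebraMap F (AlgebraicClosure F) n ^ 2) : (AlgebraicClosure F)[X]) • Affine.CoordinateRing.mk ((kubertTateFive m n).baseChange (AlgebraicClosure F)).toAffine Y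

omit hE in
/-- `f_T` reduces to `(-n x²) · 1 + (x + n²) · y` in `F̄[E_{m,n}]`. [cite: SilvermanAEC2009, Exercise 10.1(c) (PDF p. 304)] -/
theorem mk_kummer_eq :
    Affine.CoordinateRing.mk ((kubertTateFive m n).baseChange (AlgebraicClosure F)).toAffine (C (-(C (algebraMap F (AlgebraicClosure F) n) * X ^ 2)) +
      C (X + C (algebraMap F (AlgebraicClosure F) n ^ 2)) * Y) = kummerCR m n := by
  have e : ∀ p : (AlgebraicClosure F)[X], algebraMap (AlgebraicClosure F)[X] (Affine.CoordinateRing ((kubertTateFive m n).baseChange (AlgebraicClosure F)).toAffine) p =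
      Affine.CoordinateRing.mk ((kubertTateFive m n).baseChange (AlgebraicClosure F)).toAffine (C p) := fun p => rfl
  rw [kummerCR, Algebra.smul_def, Algebra.smul_def, mul_one, e, e, ← map_mul, ← map_add]

omit hE in
/-- `f_T` is `kummerCR` viewed in the function field. [cite: SilvermanAEC2009, Exercise 10.1(c) (PDF p. 304)] -/
theorem kummerFn_eq_algebraMap :
    kummerFn m n = algebraMap (Affine.CoordinateRing ((kubertTateFive m n).baseChange (AlgebraicClosure F)).toAffine) (kubertTateFive m n).geomFunctionField
      (kummerCR m n) := by
  rw [kummerFn, evalGeneric_apply, ← mk_kummer_eq, equivMvPolynomial_symm_kummerPoly]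

omit hE in
/-- `kummerCR ≠ 0` (its `y`-component `x + n²` is non-zero). [cite: SilvermanAEC2009, Exercise 10.1(c) (PDF p. 304)] -/
theorem kummerCR_ne_zero : kummerCR m n ≠ 0 := fun h0 =>
  X_add_C_ne_zero (algebraMap F (AlgebraicClosure F) n ^ 2) (Affine.CoordinateRing.smul_basis_eq_zero h0).2

omit hE in
/-- `f_T ≠ 0`. [cite: SilvermanAEC2009, Exercise 10.1(c) (PDF p. 304)] -/
theorem kummerFn_ne_zero : kummerFn m n ≠ 0 := by
  rw [kummerFn_eq_algebraMap]
  exact (map_ne_zero_iff _ (FaithfulSMul.algebraMap_injective (Affine.CoordinateRing ((kubertTateFive m n).baseChange (AlgebraicClosure F)).toAffine)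
    (kubertTateFive m n).geomFunctionField)).mpr (kummerCR_ne_zero m n)

omit hE in
/-- `f_T(a, b) = ab - na² + n²b` as the value of the regular function `kummerCR`.
[cite: SilvermanAEC2009, Exercise 10.1(c) (PDF p. 304)] -/
theorem pointEval_kummerCR {a b : (AlgebraicClosure F)} (h : ((kubertTateFive m n).baseChange (AlgebraicClosure F)).toAffine.Equation a b) :
    pointEval h (kummerCR m n) = a * b - algebraMap F (AlgebraicClosure F) n * a ^ 2 + algebraMap F (AlgebraicClosure F) n ^ 2 * b := by
  rw [← mk_kummer_eq, pointEval_mk]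
  simp only [evalEval_add, evalEval_mul, evalEval_C, evalEval_X, eval_X, eval_C, eval_mul, eval_pow,
    eval_neg, eval_add]
  ring

/-! ### The pole at `O` -/

/-- **`ord_O f_T = -5`**: the norm of `(-n x²) + (x + n²) y` has degree `max (2·2, 2·1 + 3) = 5`.
[cite: SilvermanAEC2009, Exercise 10.1(c) (PDF p. 304)] -/
theorem ord_zero_kummerFn : ord ((kubertTateFive m n).baseChange (AlgebraicClosure F)).toAffine 0 (kummerFn m n) = -5 := by
  have hn0 : algebraMap F (AlgebraicClosure F) n ≠ 0 := (_root_.map_ne_zero _).mpr (n_ne_zero m n hE)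
  have hX2 : (-(C (algebraMap F (AlgebraicClosure F) n) * X ^ 2) : (AlgebraicClosure F)[X]) ≠ 0 :=
    neg_ne_zero.mpr (mul_ne_zero (by rwa [Ne, C_eq_zero]) (pow_ne_zero 2 X_ne_zero))
  have hX1 : (X + C (algebraMap F (AlgebraicClosure F) n ^ 2) : (AlgebraicClosure F)[X]) ≠ 0 := X_add_C_ne_zero _
  have hdeg2 : (-(C (algebraMap F (AlgebraicClosure F) n) * X ^ 2) : (AlgebraicClosure F)[X]).natDegree = 2 := by
    rw [natDegree_neg, natDegree_C_mul hn0, natDegree_pow, natDegree_X]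
  rw [kummerFn_eq_algebraMap, ord_zero_algebraMap (kummerCR_ne_zero m n), kummerCR,
    normDeg_smul_basis_eq _ _ (Or.inl hX2), if_neg hX1, if_neg hX2, hdeg2, natDegree_X_add_C]
  norm_num

/-! ### The zeros: only `T` -/

/-- **The only zero of `f_T` on `E_{m,n}` is `T = (0, 0)`**: `f_T · f_{-T} = -x⁵` on the curve, so
`f_T(a, b) = 0` forces `a = 0` and then `n² b = f_T(0, b) = 0`.
[cite: SilvermanAEC2009, Exercise 10.1(c) (PDF p. 304)] -/
theorem eq_zero_of_kummer_eq_zero {m' n' a b : (AlgebraicClosure F)} (hn' : n' ≠ 0)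
    (he : b ^ 2 + (n' - m') * a * b - m' * n' ^ 2 * b = a ^ 3 - m' * n' * a ^ 2)
    (hf : a * b - n' * a ^ 2 + n' ^ 2 * b = 0) : a = 0 ∧ b = 0 := by
  have hprod : (a * b - n' * a ^ 2 + n' ^ 2 * b) *
      (a * (-b - (n' - m') * a + m' * n' ^ 2) - n' * a ^ 2 + n' ^ 2 * (-b - (n' - m') * a + m' * n' ^ 2)) =
      -a ^ 5 := by
    linear_combination (-(a ^ 2) - 2 * n' ^ 2 * a - n' ^ 4) * he
  rw [hf, zero_mul] at hprod
  have ha : a = 0 := pow_eq_zero_iff (n := 5) (by norm_num) |>.mp (neg_eq_zero.mp hprod.symm)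
  refine ⟨ha, ?_⟩
  rw [ha] at hf
  have : n' ^ 2 * b = 0 := by linear_combination hf
  exact (mul_eq_zero.mp this).resolve_left (pow_ne_zero 2 hn')

/-- `ord_Q f_T ≥ 0` at affine `Q`. [cite: SilvermanAEC2009, Exercise 10.1(c) (PDF p. 304)] -/
theorem ord_some_kummerFn_nonneg {a b : (AlgebraicClosure F)} (h : ((kubertTateFive m n).baseChange (AlgebraicClosure F)).toAffine.Nonsingular a b) :
    0 ≤ ord ((kubertTateFive m n).baseChange (AlgebraicClosure F)).toAffine (.some a b h) (kummerFn m n) := by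
  rw [kummerFn_eq_algebraMap]; exact ord_some_algebraMap_nonneg h _

/-- `ord_Q f_T > 0` at affine `Q = (a, b)` iff `ab - na² + n²b = 0`. [cite: SilvermanAEC2009, Exercise 10.1(c) (PDF p. 304)] -/
theorem ord_some_kummerFn_pos_iff {a b : (AlgebraicClosure F)} (h : ((kubertTateFive m n).baseChange (AlgebraicClosure F)).toAffine.Nonsingular a b) :
    0 < ord ((kubertTateFive m n).baseChange (AlgebraicClosure F)).toAffine (.some a b h) (kummerFn m n) ↔
      a * b - algebraMap F (AlgebraicClosure F) n * a ^ 2 + algebraMap F (AlgebraicClosure F) n ^ 2 * b = 0 := by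
  rw [kummerFn_eq_algebraMap, ord_some_algebraMap_pos_iff h (kummerCR_ne_zero m n),
    pointEval_kummerCR]

/-- `T̄` is the affine point `(0, 0)`. [cite: Knapp1993, (5.31)] -/
theorem Tbar_eq : Tbar m n = Affine.Point.some 0 0 (nonsingular_zero_zero m n) := rfl

/-- A point `Q ≠ O` with `ord_Q f_T ≠ 0` is `T̄`. [cite: SilvermanAEC2009, Exercise 10.1(c) (PDF p. 304)] -/
theorem eq_Tbar_of_ord_ne_zero {Q : ((kubertTateFive m n).baseChange (AlgebraicClosure F)).toAffine.Point} (hQ : Q ≠ 0) (hF : ord ((kubertTateFive m n).baseChange (AlgebraicClosure F)).toAffine Q (kummerFn m n) ≠ 0) :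
    Q = Affine.Point.some 0 0 (nonsingular_zero_zero m n) := by
  rcases Q with _ | ⟨a, b, h⟩
  · exact (hQ rfl).elim
  · have hpos : 0 < ord ((kubertTateFive m n).baseChange (AlgebraicClosure F)).toAffine (.some a b h) (kummerFn m n) :=
      lt_of_le_of_ne (ord_some_kummerFn_nonneg m n h) (Ne.symm hF)
    rw [ord_some_kummerFn_pos_iff m n h] at hpos
    obtain ⟨rfl, rfl⟩ := eq_zero_of_kummer_eq_zero ((_root_.map_ne_zero _).mpr (n_ne_zero m n hE))
      ((nonsingular_geom_iff m n a b).mp h) hpos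
    rfl

/-- **`ord_T f_T = 5`** (the degree of the principal divisor `div f_T` is `0`, its only pole is
`O` of order `5` and its only zero is `T`).
[cite: SilvermanAEC2009, Exercise 10.1(c) (PDF p. 304) with Prop. II.3.1(b)] -/
theorem ord_Tbar_kummerFn :
    ord ((kubertTateFive m n).baseChange (AlgebraicClosure F)).toAffine (Affine.Point.some 0 0 (nonsingular_zero_zero m n)) (kummerFn m n) = 5 := by
  set G : ((kubertTateFive m n).baseChange (AlgebraicClosure F)).toAffine.Point → ℤ := fun Q => ord ((kubertTateFive m n).baseChange (AlgebraicClosure F)).toAffine Q (kummerFn m n) with hG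
  set Z : Finset ((kubertTateFive m n).baseChange (AlgebraicClosure F)).toAffine.Point := {Affine.Point.some 0 0 (nonsingular_zero_zero m n)} with hZ
  have hZ0 : (0 : ((kubertTateFive m n).baseChange (AlgebraicClosure F)).toAffine.Point) ∉ Z := by
    rw [hZ, Finset.mem_singleton]
    exact (Affine.Point.some_ne_zero _).symm
  have hzeros : ∀ Q : ((kubertTateFive m n).baseChange (AlgebraicClosure F)).toAffine.Point, Q ≠ 0 → G Q ≠ 0 → Q ∈ Z := fun Q hQ hGQ => by
    rw [hZ, Finset.mem_singleton]
    exact eq_Tbar_of_ord_ne_zero m n hQ hGQ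
  obtain ⟨hcount, -⟩ := finsum_mul_eq_of_zeros G 5 (finite_support_ord (kummerFn_ne_zero m n))
    (finsum_ord (kummerFn_ne_zero m n)) (ord_zero_kummerFn m n) Z hZ0 hzeros
  rw [hZ, Finset.sum_singleton] at hcount
  exact_mod_cast hcount

/-- **`div f_T = 5(T) - 5(O)`**: `ord_Q f_T = 5([Q = T̄] - [Q = O])` for every geometric point
`Q` of `E_{m,n}` — the divisor hypothesis of the tree's
`WeierstrassCurve.exists_stableCoset_of_kummer_eq_pow`.
[cite: SilvermanAEC2009, Exercise 10.1(c) (PDF p. 304)] -/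
theorem ord_kummerFn (Q : geomPoints (kubertTateFive m n)) :
    ord ((kubertTateFive m n).baseChange (AlgebraicClosure F)).toAffine Q (kummerFn m n) =
      ((5 : ℕ) : ℤ) * ((if Q = Tbar m n then 1 else 0) - (if Q = 0 then 1 else 0)) := by
  by_cases hQ0 : Q = 0
  · subst hQ0
    rw [if_neg (fun h => Tbar_ne_zero m n h.symm), if_pos rfl]
    exact (ord_zero_kummerFn m n).trans (by norm_num)
  by_cases hQT : Q = Tbar m n
  · subst hQT
    rw [if_pos rfl, if_neg (Tbar_ne_zero m n)]
    exact (ord_Tbar_kummerFn m n).trans (by norm_num)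
  · rw [if_neg hQT, if_neg hQ0, sub_zero, mul_zero]
    by_contra hF
    exact hQT ((eq_Tbar_of_ord_ne_zero m n hQ0 hF).trans (Tbar_eq m n).symm)

/-! ### Values at affine points -/

omit hE in
/-- **`f_T(x, y) = xy - nx² + n²y`** at an affine geometric point. [cite: SilvermanAEC2009, Exercise 10.1(c) (PDF p. 304)] -/
theorem hasValueAt_kummerFn {x y : (AlgebraicClosure F)} (h : ((kubertTateFive m n).baseChange (AlgebraicClosure F)).toAffine.Nonsingular x y) :
    (kubertTateFive m n).HasValueAt (kummerFn m n) (Affine.Point.some x y h)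
      (x * y - algebraMap F (AlgebraicClosure F) n * x ^ 2 + algebraMap F (AlgebraicClosure F) n ^ 2 * y) := by
  have := hasValueAt_evalGeneric (W := kubertTateFive m n) (kummerPoly n) (Affine.Point.some x y h)
  rw [xy_some] at this
  simpa [kummerPoly, kummerFn] using this

end KubertTateKummer

end Literature.NumberTheory.EllipticCurves

end
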